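import Summits.CriticalPhenomena.CardyFormulaZ2.Theses.UnionJackBeffara
import Summits.CriticalPhenomena.CardyFormulaZ2.Theorems.CardyFlipRussoCoveringLegStubRussoQDerivative
import Summits.CriticalPhenomena.CardyFormulaZ2.Theorems.UnionJackBeffaraMixedInterpolationStubOddShiftPairing
import Summits.CriticalPhenomena.CardyFormulaZ2.Theorems.UnionJackBeffaraMixedInterpolationStubFlipPairing
import Summits.CriticalPhenomena.CardyFormulaZ2.Theorems.UnionJackBeffaraMixedInterpolationStubTameBrackets
import Summits.CriticalPhenomena.CardyFormulaZ2.Theorems.UnionJackBeffaraMixedInterpolationStubBracketGapZero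
import HarnessLib

/-!
# The tame reduction of crux `MixedInterpolation` (route `UnionJackBeffara`, line `registered`)

Helper file `--supports stmt-CriticalPhenomena-4559` (crux decl
`Summit.CriticalPhenomena.CardyFormulaZ2.Theses.UnionJackBeffara.MixedInterpolation`, skeleton v8
`Cruxes/MixedInterpolation/Lines/birth.lean`).  It makes importable the two kernel-checked compositions of
the skeleton that do not depend on the two open analytic stubs:

* `stub_tameTransfer` (T4, the former registered stub `stub_tameTransfer` of skeleton v3, signature
  VERBATIM = `Sig.TameTransfer`): the crux for TAME conformal rectangles (`C²` boundary loop with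
  nowhere-vanishing derivative) implies the crux for every conformal rectangle.  Proof: the `3ε` monotone
  bracketing argument from the LANDED stubs T1 `stub_tameBrackets` (p152469), T2 `stub_crossMonoInner`
  (p150525) / `stub_crossMonoOuter` (p151106), T3 `stub_bracketGapZero` (p152740): for a square model `F` of
  `R` (`exists_isSquareModel`), T3 gives a scale `s`, T1 tame brackets `R' ⊇· R ⊇· R''` at scale `s`, T2 the
  eventual inclusions `cross_δ(R'') ⊆ cross_δ(R) ⊆ cross_δ(R')` under both laws, so
  `P_{1/2}[R] − P_0[R]` is squeezed between `(P_{1/2}[R''] − P_0[R'']) − gap` and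
  `(P_{1/2}[R'] − P_0[R']) + gap` with `gap = P_0[R'] − P_0[R''] ≤ ε/2` (T3) and the bracket terms
  eventually within `ε/4` of `0` (hypothesis, brackets being tame).  No site-side estimate is used.
* `mixedInterpolation_of_tameBalance`: the crux BY NAME from the two open stubs B-tame
  (`stub_translationNullTame`: one-mesh translation null of the type-II pivotal mass, tame `R`, uniformly in
  `q`) and C2-tame (`stub_oneMeasureLabelBalanceTame`: one-measure label balance of the type-II pivotal
  mass, tame `R`), taken as hypotheses with their registered signatures verbatim.  Proof: for tame `R`,
  `M₃(q,R) = M₂(q̄, R ⊕ δw)` (odd-shift pairing A, p147348, summed: `russo_balance_algebra`),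
  `M₂(q̄,R) = M₂*(q,R)` (flip pairing C1, p147775), so `|M₂ − M₃| ≤ C2(q) + B(q̄) < ε` uniformly in `q`;
  this is the balance hypothesis of the tree's Russo-in-`q` theorem `russo_mixedInterpolation_of_balance`
  (Beffara Prop. 18 + MVT), window finiteness being `uj_window_finite`; then `stub_tameTransfer`.

So after this file the crux is, importably, EQUIVALENT-BY-IMPLICATION to `B-tame ∧ C2-tame`; both are
analytic estimates on near-critical arm events of the mixed family (Beffara's eq. (almost) summed, and his
"what is missing"), not in the tree or in print.

References: V. Beffara, *Is critical 2D percolation universal?*, Progr. Probab. 60 (2008) 31–58,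
arXiv:0708.3908, §5.2 (Def. 17, Prop. 18, eq. (almost)) [Beffara2008Universal]; O. Schramm, S. Smirnov,
*On the scaling limits of planar percolation*, Ann. Probab. 39 (2011), Lemma 5.1 and §1.3
[SchrammSmirnov2011].
-/

noncomputable section

namespace Summit.CriticalPhenomena.CardyFormulaZ2.Cruxes.MixedInterpolation.Registered

open Set Filter Topology MeasureTheory
open Literature.Probability.LatticeModels Literature.Probability.Percolation
open Literature.Probability.RandomPlanarGeometry
open Literature.Barriers.CriticalPhenomena (MixedSite mixedParam)
open Summit.CriticalPhenomena.CardyFormulaZ2.Cruxes.CoveringLeg.FiveArmNull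
  (russo_mixedInterpolation_of_balance russo_finite_box)

/-! ### T4 — the tame-to-general transfer (former registered stub `stub_tameTransfer`) -/

/-- **T4 — tame-to-general transfer** (`Sig.TameTransfer` of the skeleton, verbatim): if
`P_{1/2}[cross_δ R] − P_0[cross_δ R] → 0` for every TAME conformal rectangle `R` (`C²` boundary loop,
nowhere-vanishing derivative), then it holds for every conformal rectangle.  The `3ε` monotone bracketing:
scale `s` from T3 at `ε/2`, tame brackets from T1, eventual inclusions of the crude crossing events from T2
under both laws, bracket terms `< ε/4` by hypothesis. [cite: SchrammSmirnov2011, Lemma 5.1 and §1.3] -/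
theorem stub_tameTransfer :
    (∀ R : Literature.Probability.RandomPlanarGeometry.ConformalRectangle,
      (ContDiff ℝ 2 R.boundary ∧ ∀ t : ℝ, deriv R.boundary t ≠ 0) →
        Filter.Tendsto (fun δ : ℝ =>
          (prodBernoulli (mixedParam Literature.Probability.Percolation.half)).real
              (siteEmbDomainCrossing unionJackGraph unionJackEmbed R.carrier δ (R.arc 0) (R.arc 2)) -
            (prodBernoulli (mixedParam 0)).real
              (siteEmbDomainCrossing unionJackGraph unionJackEmbed R.carrier δ (R.arc 0) (R.arc 2)))
        (nhdsWithin 0 (Set.Ioi 0)) (nhds 0)) →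
    ∀ R : Literature.Probability.RandomPlanarGeometry.ConformalRectangle,
        Filter.Tendsto (fun δ : ℝ =>
          (prodBernoulli (mixedParam Literature.Probability.Percolation.half)).real
              (siteEmbDomainCrossing unionJackGraph unionJackEmbed R.carrier δ (R.arc 0) (R.arc 2)) -
            (prodBernoulli (mixedParam 0)).real
              (siteEmbDomainCrossing unionJackGraph unionJackEmbed R.carrier δ (R.arc 0) (R.arc 2)))
        (nhdsWithin 0 (Set.Ioi 0)) (nhds 0) := by
  intro hTame R
  obtain ⟨F, hF⟩ := Literature.Probability.Percolation.exists_isSquareModel R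
  rw [Metric.tendsto_nhds]
  intro ε hε
  obtain ⟨s, hs, hs4, hgap⟩ := stub_bracketGapZero R F hF (ε / 2) (half_pos hε)
  obtain ⟨⟨R', hR't, hW1, hW2, hW3a, hW3b, hU1, hU2a, hU2b⟩,
      ⟨R'', hR''t, hN1, hN2a, hN2b, hL, hN3a, hN3b, hN4⟩⟩ :=
    stub_tameBrackets R F hF s hs hs4
  have hin := stub_crossMonoInner R R'' F hF s hs hN1 hN2a hN2b
  have hout := stub_crossMonoOuter R R' F hF s hs hs4 hW1 hW2 hW3a hW3b
  have hg := hgap R' R'' ⟨hW1, hW2, hW3a, hW3b, hU1, hU2a, hU2b⟩ ⟨hN1, hN2a, hN2b, hL, hN3a, hN3b, hN4⟩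
  have h1 := (Metric.tendsto_nhds.1 (hTame R' hR't)) (ε / 4) (by positivity)
  have h2 := (Metric.tendsto_nhds.1 (hTame R'' hR''t)) (ε / 4) (by positivity)
  filter_upwards [hin, hout, hg, h1, h2] with δ hδin hδout hδg hδ1 hδ2
  rw [Real.dist_eq, sub_zero, abs_lt] at hδ1 hδ2 ⊢
  have m1 : (prodBernoulli (mixedParam half)).real
        (siteEmbDomainCrossing unionJackGraph unionJackEmbed R.carrier δ (R.arc 0) (R.arc 2)) ≤
      (prodBernoulli (mixedParam half)).real
        (siteEmbDomainCrossing unionJackGraph unionJackEmbed R'.carrier δ (R'.arc 0) (R'.arc 2)) :=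
    measureReal_mono hδout
  have m2 : (prodBernoulli (mixedParam half)).real
        (siteEmbDomainCrossing unionJackGraph unionJackEmbed R''.carrier δ (R''.arc 0) (R''.arc 2)) ≤
      (prodBernoulli (mixedParam half)).real
        (siteEmbDomainCrossing unionJackGraph unionJackEmbed R.carrier δ (R.arc 0) (R.arc 2)) :=
    measureReal_mono hδin
  have m3 : (prodBernoulli (mixedParam 0)).real
        (siteEmbDomainCrossing unionJackGraph unionJackEmbed R.carrier δ (R.arc 0) (R.arc 2)) ≤
      (prodBernoulli (mixedParam 0)).real
        (siteEmbDomainCrossing unionJackGraph unionJackEmbed R'.carrier δ (R'.arc 0) (R'.arc 2)) :=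
    measureReal_mono hδout
  have m4 : (prodBernoulli (mixedParam 0)).real
        (siteEmbDomainCrossing unionJackGraph unionJackEmbed R''.carrier δ (R''.arc 0) (R''.arc 2)) ≤
      (prodBernoulli (mixedParam 0)).real
        (siteEmbDomainCrossing unionJackGraph unionJackEmbed R.carrier δ (R.arc 0) (R.arc 2)) :=
    measureReal_mono hδin
  constructor <;> linarith [hδ1.1, hδ1.2, hδ2.1, hδ2.2, hδg]

/-! ### Window finiteness for the covering-adapted embedding -/

/-- If `δ · (m + n i)/2` has norm at most `C` (`δ > 0`), then `|m|, |n| ≤ 2C/δ`. [folklore] -/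
theorem uj_abs_le_of_norm_le {m n : ℤ} {δ C : ℝ} (hδ : 0 < δ)
    (h : ‖(δ : ℂ) * (((m : ℂ) + (n : ℂ) * Complex.I) / 2)‖ ≤ C) :
    |(m : ℝ)| ≤ 2 * C / δ ∧ |(n : ℝ)| ≤ 2 * C / δ := by
  have h2 : ‖(2 : ℂ)‖ = 2 := Complex.norm_two
  have hnorm : ‖(δ : ℂ) * (((m : ℂ) + (n : ℂ) * Complex.I) / 2)‖ =
      δ * ‖(m : ℂ) + (n : ℂ) * Complex.I‖ / 2 := by
    rw [norm_mul, norm_div, Complex.norm_real, Real.norm_of_nonneg hδ.le, h2, mul_div_assoc]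
  rw [hnorm] at h
  have hw : ‖(m : ℂ) + (n : ℂ) * Complex.I‖ ≤ 2 * C / δ := by
    rw [le_div_iff₀ hδ]
    linarith
  have hre : |(m : ℝ)| ≤ ‖(m : ℂ) + (n : ℂ) * Complex.I‖ := by
    have := Complex.abs_re_le_norm ((m : ℂ) + (n : ℂ) * Complex.I)
    simpa using this
  have him : |(n : ℝ)| ≤ ‖(m : ℂ) + (n : ℂ) * Complex.I‖ := by
    have := Complex.abs_im_le_norm ((m : ℂ) + (n : ℂ) * Complex.I)
    simpa using this
  exact ⟨hre.trans hw, him.trans hw⟩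

/-- **Window finiteness**: for a bounded `Ω` and `δ > 0` only finitely many type-I sites and finitely
many face centres of `δ G_s` (covering-adapted embedding `unionJackEmbed`, values in `½ℤ[i]`) are mapped
into `Ω` — the hypothesis `hfin` of the Russo theorem `russo_mixedInterpolation_of_balance`.
[cite: Beffara2008Universal, §5.1] -/
theorem uj_window_finite {Ω : Set ℂ} (hΩ : Bornology.IsBounded Ω) {δ : ℝ} (hδ : 0 < δ) :
    {x : ℤ × ℤ | (δ : ℂ) * unionJackEmbed (Sum.inl x) ∈ Ω}.Finite ∧
      {f : ℤ × ℤ | (δ : ℂ) * unionJackEmbed (Sum.inr f) ∈ Ω}.Finite := by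
  obtain ⟨C, hC⟩ := isBounded_iff_forall_norm_le.1 hΩ
  constructor
  · refine (russo_finite_box (2 * C / δ + 1)).subset ?_
    intro x hx
    have hx' : ‖(δ : ℂ) * ((((x.1 + x.2 : ℤ) : ℂ) + ((x.2 - x.1 + 1 : ℤ) : ℂ) * Complex.I) / 2)‖ ≤ C := by
      have := hC _ hx
      simpa only [unionJackEmbed_inl] using this
    obtain ⟨h1, h2⟩ := uj_abs_le_of_norm_le hδ hx'
    push_cast at h1 h2
    rw [abs_le] at h1 h2
    simp only [Set.mem_setOf_eq, abs_le]
    constructor <;> constructor <;> linarith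
  · refine (russo_finite_box (2 * C / δ + 1)).subset ?_
    intro f hf
    have hf' : ‖(δ : ℂ) * ((((f.1 + f.2 + 1 : ℤ) : ℂ) + ((f.2 + 1 - f.1 : ℤ) : ℂ) * Complex.I) / 2)‖ ≤ C := by
      have := hC _ hf
      simpa only [unionJackEmbed_inr] using this
    obtain ⟨h1, h2⟩ := uj_abs_le_of_norm_le hδ hf'
    push_cast at h1 h2
    rw [abs_le] at h1 h2
    simp only [Set.mem_setOf_eq, abs_le]
    constructor <;> constructor <;> linarith

/-! ### The algebra of the four pivotal masses -/

/-- **Stub A summed + C1 + triangle inequality, abstractly.**  For real families `a b b' c` on the faces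
`ℤ × ℤ` with the odd-shift pairing `a (f.1 + 1, f.2) = b f` (A) and the flip pairing `b' = c` (C1), the
type-III sum of `a` IS the type-II sum of `b` (reindexing by the permutation `f ↦ (f.1 + 1, f.2)`, which
exchanges the parities; `Equiv.tsum_eq`, no summability needed), so
`|Σ_even a − Σ_odd a| ≤ |Σ_even a − Σ_even c| + |Σ_even b − Σ_even b'|`.
[cite: Beffara2008Universal, §5.2] -/
theorem russo_balance_algebra (a b b' c : ℤ × ℤ → ℝ) {ε : ℝ}
    (hA : ∀ f : ℤ × ℤ, a (f.1 + 1, f.2) = b f) (hC1 : ∀ f : ℤ × ℤ, b' f = c f)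
    (hB : |(∑' f : ℤ × ℤ, if Even (f.1 + f.2) then b f else 0) -
        (∑' f : ℤ × ℤ, if Even (f.1 + f.2) then b' f else 0)| < ε / 2)
    (hC2 : |(∑' f : ℤ × ℤ, if Even (f.1 + f.2) then a f else 0) -
        (∑' f : ℤ × ℤ, if Even (f.1 + f.2) then c f else 0)| < ε / 2) :
    |(∑' f : ℤ × ℤ, if Even (f.1 + f.2) then a f else 0) -
        (∑' f : ℤ × ℤ, if Even (f.1 + f.2) then 0 else a f)| < ε := by
  -- the odd-shift permutation of the faces
  let e : ℤ × ℤ ≃ ℤ × ℤ := Equiv.prodCongr (Equiv.addRight (1 : ℤ)) (Equiv.refl ℤ)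
  have he : ∀ f : ℤ × ℤ, e f = (f.1 + 1, f.2) := fun f => rfl
  have hodd : (∑' f : ℤ × ℤ, if Even (f.1 + f.2) then 0 else a f) =
      ∑' f : ℤ × ℤ, if Even (f.1 + f.2) then b f else 0 := by
    rw [← Equiv.tsum_eq e (fun g : ℤ × ℤ => if Even (g.1 + g.2) then 0 else a g)]
    refine tsum_congr fun f => ?_
    rw [he]
    have hpar : Even (f.1 + 1 + f.2) ↔ ¬ Even (f.1 + f.2) := by
      rw [show f.1 + 1 + f.2 = (f.1 + f.2) + 1 by ring, Int.even_add_one]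
    by_cases h : Even (f.1 + f.2)
    · rw [if_neg (fun h' => hpar.1 h' h), if_pos h, hA]
    · rw [if_pos (hpar.2 h), if_neg h]
  have hc : (∑' f : ℤ × ℤ, if Even (f.1 + f.2) then b' f else 0) =
      ∑' f : ℤ × ℤ, if Even (f.1 + f.2) then c f else 0 := by
    refine tsum_congr fun f => ?_
    by_cases h : Even (f.1 + f.2)
    · rw [if_pos h, if_pos h, hC1]
    · rw [if_neg h, if_neg h]
  rw [hodd]
  rw [hc] at hB
  calc |(∑' f : ℤ × ℤ, if Even (f.1 + f.2) then a f else 0) -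
          (∑' f : ℤ × ℤ, if Even (f.1 + f.2) then b f else 0)|
      ≤ |(∑' f : ℤ × ℤ, if Even (f.1 + f.2) then a f else 0) -
            (∑' f : ℤ × ℤ, if Even (f.1 + f.2) then c f else 0)| +
          |(∑' f : ℤ × ℤ, if Even (f.1 + f.2) then c f else 0) -
            (∑' f : ℤ × ℤ, if Even (f.1 + f.2) then b f else 0)| := abs_sub_le _ _ _
    _ < ε / 2 + ε / 2 := add_lt_add hC2 (by rwa [abs_sub_comm] at hB)
    _ = ε := add_halves ε

/-! ### The crux from B-tame and C2-tame -/

/-- **The crux `MixedInterpolation` from the two open analytic stubs** (hypotheses = the registered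
signatures of `stub_translationNullTame` and `stub_oneMeasureLabelBalanceTame`, verbatim).  For TAME `R`
the balance `|M₂(q,R,δ) − M₃(q,R,δ)| < ε` (uniformly in `q`, eventually in `δ`) follows from the landed
pairings A (`stub_oddShiftPairing`) and C1 (`stub_flipPairing`) by `russo_balance_algebra` with B-tame at
`q̄ = 1 − q` and C2-tame at `q`; it is the hypothesis `hV` of `russo_mixedInterpolation_of_balance`
(Beffara Prop. 18 + MVT, window `uj_window_finite`), whose conclusion is the crux for `R`; the transfer
`stub_tameTransfer` removes tameness; the route's `let Z G P` form is `rfl`.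
[cite: Beffara2008Universal, §5.2 Prop. 18] -/
theorem mixedInterpolation_of_tameBalance
    (hB : ∀ R : Literature.Probability.RandomPlanarGeometry.ConformalRectangle,
      (ContDiff ℝ 2 R.boundary ∧ ∀ t : ℝ, deriv R.boundary t ≠ 0) → ∀ ε : ℝ, 0 < ε →
      ∃ δ₀ : ℝ, 0 < δ₀ ∧ ∀ δ : ℝ, 0 < δ → δ < δ₀ → ∀ q : unitInterval,
        |(∑' f : ℤ × ℤ, if Even (f.1 + f.2) then (prodBernoulli (mixedParam q)).real
            {ω | insert (Sum.inr f) ω ∈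
                  siteEmbDomainCrossing unionJackGraph unionJackEmbed
                    (R.map (similarity 1 one_ne_zero ((δ : ℂ) * ((Complex.I - 1) / 2)))).carrier δ
                    ((R.map (similarity 1 one_ne_zero ((δ : ℂ) * ((Complex.I - 1) / 2)))).arc 0)
                    ((R.map (similarity 1 one_ne_zero ((δ : ℂ) * ((Complex.I - 1) / 2)))).arc 2) ∧
                ω \ {Sum.inr f} ∉
                  siteEmbDomainCrossing unionJackGraph unionJackEmbed
                    (R.map (similarity 1 one_ne_zero ((δ : ℂ) * ((Complex.I - 1) / 2)))).carrier δ
                    ((R.map (similarity 1 one_ne_zero ((δ : ℂ) * ((Complex.I - 1) / 2)))).arc 0)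
                    ((R.map (similarity 1 one_ne_zero ((δ : ℂ) * ((Complex.I - 1) / 2)))).arc 2)}
            else 0) -
          (∑' f : ℤ × ℤ, if Even (f.1 + f.2) then (prodBernoulli (mixedParam q)).real
            {ω | insert (Sum.inr f) ω ∈
                  siteEmbDomainCrossing unionJackGraph unionJackEmbed R.carrier δ (R.arc 0) (R.arc 2) ∧
                ω \ {Sum.inr f} ∉
                  siteEmbDomainCrossing unionJackGraph unionJackEmbed R.carrier δ (R.arc 0) (R.arc 2)}
            else 0)| < ε)
    (hC2 : ∀ R : Literature.Probability.RandomPlanarGeometry.ConformalRectangle,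
      (ContDiff ℝ 2 R.boundary ∧ ∀ t : ℝ, deriv R.boundary t ≠ 0) → ∀ ε : ℝ, 0 < ε →
      ∃ δ₀ : ℝ, 0 < δ₀ ∧ ∀ δ : ℝ, 0 < δ → δ < δ₀ → ∀ q : unitInterval,
        |(∑' f : ℤ × ℤ, if Even (f.1 + f.2) then (prodBernoulli (mixedParam q)).real
            {ω | insert (Sum.inr f) ω ∈
                  siteEmbDomainCrossing unionJackGraph unionJackEmbed R.carrier δ (R.arc 0) (R.arc 2) ∧
                ω \ {Sum.inr f} ∉
                  siteEmbDomainCrossing unionJackGraph unionJackEmbed R.carrier δ (R.arc 0) (R.arc 2)}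
            else 0) -
          (∑' f : ℤ × ℤ, if Even (f.1 + f.2) then (prodBernoulli (mixedParam q)).real
            {ω | insert (Sum.inr f) ω ∈
                  {ω' : Set Literature.Barriers.CriticalPhenomena.MixedSite |
                    ω'ᶜ ∉ siteEmbDomainCrossing unionJackGraph unionJackEmbed R.carrier δ (R.arc 0) (R.arc 2)} ∧
                ω \ {Sum.inr f} ∉
                  {ω' : Set Literature.Barriers.CriticalPhenomena.MixedSite |
                    ω'ᶜ ∉ siteEmbDomainCrossing unionJackGraph unionJackEmbed R.carrier δ (R.arc 0) (R.arc 2)}}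
            else 0)| < ε) :
    Summit.CriticalPhenomena.CardyFormulaZ2.Theses.UnionJackBeffara.MixedInterpolation := by
  show ∀ R : ConformalRectangle, Tendsto (fun δ : ℝ =>
      (prodBernoulli (mixedParam half)).real
          (siteEmbDomainCrossing unionJackGraph unionJackEmbed R.carrier δ (R.arc 0) (R.arc 2)) -
        (prodBernoulli (mixedParam 0)).real
          (siteEmbDomainCrossing unionJackGraph unionJackEmbed R.carrier δ (R.arc 0) (R.arc 2)))
    (𝓝[>] 0) (𝓝 0)
  refine stub_tameTransfer (fun R hR => ?_)
  refine russo_mixedInterpolation_of_balance unionJackGraph unionJackEmbed R.carrier (R.arc 0) (R.arc 2)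
    (fun _ hδ => uj_window_finite R.isBounded hδ) (fun ε hε => ?_)
  obtain ⟨δ₁, hδ₁, h₁⟩ := hC2 R hR (ε / 2) (half_pos hε)
  obtain ⟨δ₂, hδ₂, h₂⟩ := hB R hR (ε / 2) (half_pos hε)
  refine ⟨min δ₁ δ₂, lt_min hδ₁ hδ₂, fun δ hδ hδlt q => ?_⟩
  have hC' := h₁ δ hδ (lt_of_lt_of_le hδlt (min_le_left _ _)) q
  have hB' := h₂ δ hδ (lt_of_lt_of_le hδlt (min_le_right _ _)) (unitInterval.symm q)
  exact russo_balance_algebra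
    (fun f => (prodBernoulli (mixedParam q)).real
      {ω | insert (Sum.inr f) ω ∈
            siteEmbDomainCrossing unionJackGraph unionJackEmbed R.carrier δ (R.arc 0) (R.arc 2) ∧
          ω \ {Sum.inr f} ∉
            siteEmbDomainCrossing unionJackGraph unionJackEmbed R.carrier δ (R.arc 0) (R.arc 2)})
    (fun f => (prodBernoulli (mixedParam (unitInterval.symm q))).real
      {ω | insert (Sum.inr f) ω ∈
            siteEmbDomainCrossing unionJackGraph unionJackEmbed
              (R.map (similarity 1 one_ne_zero ((δ : ℂ) * ((Complex.I - 1) / 2)))).carrier δ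
              ((R.map (similarity 1 one_ne_zero ((δ : ℂ) * ((Complex.I - 1) / 2)))).arc 0)
              ((R.map (similarity 1 one_ne_zero ((δ : ℂ) * ((Complex.I - 1) / 2)))).arc 2) ∧
          ω \ {Sum.inr f} ∉
            siteEmbDomainCrossing unionJackGraph unionJackEmbed
              (R.map (similarity 1 one_ne_zero ((δ : ℂ) * ((Complex.I - 1) / 2)))).carrier δ
              ((R.map (similarity 1 one_ne_zero ((δ : ℂ) * ((Complex.I - 1) / 2)))).arc 0)
              ((R.map (similarity 1 one_ne_zero ((δ : ℂ) * ((Complex.I - 1) / 2)))).arc 2)})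
    (fun f => (prodBernoulli (mixedParam (unitInterval.symm q))).real
      {ω | insert (Sum.inr f) ω ∈
            siteEmbDomainCrossing unionJackGraph unionJackEmbed R.carrier δ (R.arc 0) (R.arc 2) ∧
          ω \ {Sum.inr f} ∉
            siteEmbDomainCrossing unionJackGraph unionJackEmbed R.carrier δ (R.arc 0) (R.arc 2)})
    (fun f => (prodBernoulli (mixedParam q)).real
      {ω | insert (Sum.inr f) ω ∈
            {ω' : Set MixedSite |
              ω'ᶜ ∉ siteEmbDomainCrossing unionJackGraph unionJackEmbed R.carrier δ (R.arc 0) (R.arc 2)} ∧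
          ω \ {Sum.inr f} ∉
            {ω' : Set MixedSite |
              ω'ᶜ ∉ siteEmbDomainCrossing unionJackGraph unionJackEmbed R.carrier δ (R.arc 0) (R.arc 2)}})
    (fun f => stub_oddShiftPairing q R δ f) (fun f => stub_flipPairing q R δ f) hB' hC'

end Summit.CriticalPhenomena.CardyFormulaZ2.Cruxes.MixedInterpolation.Registered

end
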